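/-
Copyright: the b2b-balaban cell (near-miss cell 7), T⁴-continuum fan-out, NE7b ROUND-2 swarm `t4-ne7b-formalise-*`
(seat leaf-07, gen 2), row S6 pt 3b∕3c «zones of realised histories» AT LEVELS (owner's ruling R-OWNER-22-15) of
lineage t4-ne7b-p1's claim table `LEAVES-NE7b.md`.  Part 3b-III: the realised placement and the consumers.
Released under the licence of the surrounding project.
-/
import Summits.QuantumFields.BalabanUV.T4Continuum.Support.HistoryZonesOrbitRealise

/-!
# History zones from orbits, III: the realised placement is zone-admissible at levels; the multiplicity

Summits-side support leaf of the T⁴-continuum cell (rung (B)+1 on a FINITE torus only; NOT infinite volume, NOT the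
mass gap, NOT the Clay statement; NOT a proof of the spine estimate NE7b).  Row S6 pt 3b∕3c (R-OWNER-22-15), sequel of
`HistoryZonesOrbitRealise` (`Corr`, `birthRegionsD_of_corr`): the REALISED PLACEMENT of the birth labels — each at the
corner cell `L^{lv j}·(anchor mod n·L^{K − lv j})` of its anchor cube at the level of its shape-step — satisfies the
positional facts (p1)(p2) of the levelled reading, hence (`HistoryZonesDropsRegions.admZ_of_birthRegionsD` ∕
`card_admZSet_le_of_birthRegionsD`) the placement is zone-admissible for the levelled nearness with deflator, and the
zone-admissible placements obey row S6's multiplicity bound with window drops.  [folklore] bookkeeping; nothing is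
quoted from print, nothing printed is asserted, no `[cite:]` tag, no `Prop` fact minted.

WHAT.  §1 `placeD` (data), `placeD_val`, `isScale_placeD` (p1), `block_placeD_mem` (p2).  §2 **`admZ_of_corr_realises`**,
**`card_admZSet_le_of_corr_realises`** (shape `(2^d σ^{−2d}(C₀+2c₀+1)^d)^{#merges}·∏ Q(wcntS sh G,σ,·)^d·(L^d)^{partnerAges
(step∘sh)}`, `Cb = 4·2^d`, collar `32`, any `0 < σ < 1` with `1 ≤ L·σ⁴`; displayed besides `Corr`∕`Realises`: `WF`,
`Chrono (step∘sh)`, non-kind-`0` merger shapes — rows S4∕S5 facts of leaf-09's `genT`).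

HONEST DEPENDENCY (cell): continuum YM on T⁴ ⇐ BetaPertH ∧ nine spine estimates (0/9 proved); BetaPertH ⇐ (D1) ∧ (D4)
∧ CAP+tail; G-an2-4 gates asym, D1 and NE2/3/4.  This file changes none of it.  NE7b NOT proved.
-/

open Finset
open Literature.MathematicalPhysics.QuantumFieldTheory.Balaban1983to89
open Literature.MathematicalPhysics.QuantumFieldTheory.Balaban1983to89.B13ScaleTransfer
open Literature.MathematicalPhysics.QuantumFieldTheory.Balaban1983to89.TreeLength
open Literature.MathematicalPhysics.QuantumFieldTheory.Balaban1983to89.B16SProfile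
open T4PersistenceDictionary T4PartnerMultiplicity
open Summit.QuantumFields.BalabanUV.T4Continuum.PlacementSkeleton
open Summit.QuantumFields.BalabanUV.T4Continuum.Crowding
open Summit.QuantumFields.BalabanUV.T4Continuum.ZoneSkeleton
open Summit.QuantumFields.BalabanUV.T4Continuum.ZoneCrowd
open Summit.QuantumFields.BalabanUV.T4Continuum.ZoneTorus
open Summit.QuantumFields.BalabanUV.T4Continuum.HistoryAdmissible
open Summit.QuantumFields.BalabanUV.T4Continuum.HistoryRealise
open Summit.QuantumFields.BalabanUV.T4Continuum.HistoryRealiseCells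

namespace Summit.QuantumFields.BalabanUV.T4Continuum.HistoryZones

noncomputable section

variable {d : ℕ} {ε : Type*} [DecidableEq ε] (sh : ε → PEv) (pay : ε → Pt d × Finset (Pt d))

/-! ## §1 The realised placement -/

/-- **THE REALISED PLACEMENT**: a birth label sits at the corner cell `L^{lv j}·(anchor mod n·L^{K − lv j})` of its
anchor cube at the level `lv j` of its shape-step (reduced into the fine torus; no wrap when `lv j ≤ K`). [folklore] -/
def placeD (n L K : ℕ) (hN : 0 < n * L ^ K) (lv : ℕ → ℕ) (b : ε) : TCell d (n * L ^ K) := fun i =>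
  ⟨(L ^ lv (sh b).step * res (n * L ^ (K - lv (sh b).step)) ((pay b).1 i)) % (n * L ^ K), Nat.mod_lt _ hN⟩

omit [DecidableEq ε] in
/-- no wrap: at a level `≤ K` the placement's coordinates are `L^{lv}·(anchor mod n·L^{K − lv})` [folklore] -/
theorem placeD_val {n L K : ℕ} (hN : 0 < n * L ^ K) {lv : ℕ → ℕ} {b : ε} (hlv : lv (sh b).step ≤ K) (i : Fin d) :
    (placeD sh pay n L K hN lv b i).val =
      L ^ lv (sh b).step * res (n * L ^ (K - lv (sh b).step)) ((pay b).1 i) := by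
  have hn : 0 < n := Nat.pos_of_mul_pos_right hN
  have hL : 0 < L ^ (K - lv (sh b).step) := by
    rcases Nat.eq_zero_or_pos L with h | h
    · subst h
      rcases Nat.eq_zero_or_pos K with hK | hK
      · subst hK; simp
      · simp [zero_pow hK.ne'] at hN
    · exact pow_pos h _
  have hlt : res (n * L ^ (K - lv (sh b).step)) ((pay b).1 i) < n * L ^ (K - lv (sh b).step) :=
    res_lt (Nat.mul_pos hn hL) _
  refine Nat.mod_eq_of_lt ?_
  calc L ^ lv (sh b).step * res (n * L ^ (K - lv (sh b).step)) ((pay b).1 i)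
      < L ^ lv (sh b).step * (n * L ^ (K - lv (sh b).step)) := Nat.mul_lt_mul_of_pos_left hlt (by
          rcases Nat.eq_zero_or_pos L with h | h
          · subst h
            rcases Nat.eq_zero_or_pos (lv (sh b).step) with h0 | h0
            · simp [h0]
            · exfalso
              have hK : 0 < K := lt_of_lt_of_le h0 hlv
              simp [zero_pow hK.ne'] at hN
          · exact pow_pos h _)
    _ = n * L ^ K := by
        rw [mul_left_comm, ← pow_add, Nat.add_sub_cancel' hlv]

omit [DecidableEq ε] in
/-- (p1) the placement of a birth label is a cell of the level of its shape-step [folklore] -/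
theorem isScale_placeD {n L K : ℕ} (hN : 0 < n * L ^ K) {lv : ℕ → ℕ} {b : ε} (hlv : lv (sh b).step ≤ K) :
    IsScale L (lv (sh b).step) (placeD sh pay n L K hN lv b) := fun i => by
  rw [placeD_val sh pay hN hlv]
  exact dvd_mul_right _ _

omit [DecidableEq ε] in
/-- (p2) the level-`lv j` block of the placement is the reduced anchor, a cell of the reduced region when the anchor
lies in the region [folklore] -/
theorem block_placeD_mem {n L K : ℕ} (hN : 0 < n * L ^ K) (hL : 0 < L) {lv : ℕ → ℕ} {b : ε}
    (hlv : lv (sh b).step ≤ K) (hanc : (pay b).1 ∈ (pay b).2) :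
    (fun i => (placeD sh pay n L K hN lv b i).val / L ^ lv (sh b).step) ∈ regR sh pay n L K lv b := by
  have heq : (fun i => (placeD sh pay n L K hN lv b i).val / L ^ lv (sh b).step) =
      fun i => res (n * L ^ (K - lv (sh b).step)) ((pay b).1 i) := by
    funext i
    rw [placeD_val sh pay hN hlv, Nat.mul_div_cancel_left _ (pow_pos hL _)]
  rw [heq]
  exact mem_image.2 ⟨(pay b).1, hanc, rfl⟩

variable {sh pay}

/-! ## §2 The consumers -/

section Consumers

variable {L : ℕ} (hL : 3 ≤ L) {n : ℕ} (hn : 0 < n) {s : ℕ → ℕ} (hs : ∀ t, s (t + 1) ≤ s t)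
  (hdrop : ∀ m, DropCtl s m) {R : ℕ → ℕ} {K : ℕ}
include hL hn hs hdrop

open scoped Classical

/-- **THE REALISED PLACEMENT OF A REALISED CORRESPONDING HISTORY IS ZONE-ADMISSIBLE AT LEVELS** (nearness `nearD`
with deflator `theta (levelOf s K) ϑ`, deflated extents `extD` over the reduced-region zones `regZoneD … 32 …`):
displayed besides the correspondence and the realisation — chronology of `G` for `step ∘ sh` (row S5) and its
finite-alphabet copy `G′`. [folklore] -/
theorem admZ_of_corr_realises {P : PGen (Pt d × Finset (Pt d))} {G : Gen ε} {Z : Finset (Pt d)}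
    (hc : Corr sh pay G P) (hR : Realises L s R P Z) (hK : P.lastStep ≤ K) {ϑ : ℝ} (hϑ : 0 < ϑ) (hϑ1 : ϑ ≤ 1)
    (hchr : Chrono (PEv.step ∘ sh) G) {E : Finset ε} {G' : Gen ↥E} (hGG : gmap Subtype.val G' = G)
    (hN : 0 < n * L ^ K) :
    AdmZ (nearD n L K (levelOf s K) (theta (levelOf s K) ϑ))
      (fun t W => extD sh n L K (levelOf s K) ϑ G
        (regZoneD sh n L K (levelOf s K) 32 (regR sh pay n L K (levelOf s K))) t (gmap Subtype.val W))
      ((PEv.step ∘ sh) ∘ Subtype.val) G' (fun b => placeD sh pay n L K hN (levelOf s K) b.1) := by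
  have hL0 : 0 < L := by omega
  have hsK : ∀ u, u < K → s (u + 1) ≤ s u := fun u _ => hs u
  have hLF := levelFn_levelOf hsK (hdrop K)
  have hev : ∀ e ∈ G.events, (sh e).step ≤ K := fun e he => (events_step_le_of_corr P G Z hc hR e he).trans hK
  have hlvK : ∀ b : ↥E, b.1 ∈ births G → levelOf s K (sh b.1).step ≤ K := fun b hb =>
    hLF.le_K _ (hev b.1 (births_subset_events G hb))
  exact admZ_of_birthRegionsD (sh := sh) (by omega) hLF hϑ hϑ1 hchr hev (leafStep_of_corr P G hc)
    (birthRegionsD_of_corr hL hn hs hdrop hc hR hK) hGG _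
    (fun b hb => isScale_placeD sh pay hN (hlvK b hb))
    (fun b hb => block_placeD_mem sh pay hN hL0 (hlvK b hb) (births_facts_of_corr P G Z hc hR b.1 hb).2.1)

/-- **THE (GM) MULTIPLICITY OF A REALISED CORRESPONDING HISTORY, WITH WINDOW-DROP STEPS** (row S6's shape with
`Kz ↦ σ^{−2d}·Kz`, `Cb = 4·2^d`, collar `32`, `c₀ = 65∕(1−σ²)`, `C₀ = max (4·2^d + 64) (c₀ + 1)`; any rate `0 < σ < 1`
with `1 ≤ L·σ⁴`): the zone-admissible placements of the finite-alphabet copy of `G` with the root at `z` number at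
most `(2^d σ^{−2d}(C₀+2c₀+1)^d)^{#merges G}·∏_{e ∈ merges G} Q(wcntS sh G,σ,(sh e).step)^d·(L^d)^{partnerAges (step∘sh) G}`.
[folklore] -/
theorem card_admZSet_le_of_corr_realises (W : ε → ℕ) {P : PGen (Pt d × Finset (Pt d))} {G : Gen ε}
    {Z : Finset (Pt d)} (hc : Corr sh pay G P) (hR : Realises L s R P Z) (hK : P.lastStep ≤ K) {σ : ℝ}
    (h0 : 0 < σ) (h1 : σ < 1) (hσL : 1 ≤ (L : ℝ) * σ ^ 4) (hW : G.WF W) (hchr : Chrono (PEv.step ∘ sh) G)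
    (hk2 : ∀ m ∈ merges G, (sh m).kind ≠ 0) (E : Finset ε) (hE : G.events ⊆ E) (z c₀' : TCell d (n * L ^ K)) :
    ((admZSet (nearD n L K (levelOf s K) (theta (levelOf s K) (σ ^ 2)))
        (fun t W => extD sh n L K (levelOf s K) (σ ^ 2) G
          (regZoneD sh n L K (levelOf s K) 32 (regR sh pay n L K (levelOf s K))) t (gmap Subtype.val W))
        ((PEv.step ∘ sh) ∘ Subtype.val) (grestrict E G hE) (grestrict E G hE).root z c₀').card : ℝ) ≤
      ((2 : ℝ) ^ d * (σ ^ 2)⁻¹ ^ d *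
          (max ((4 : ℝ) * 2 ^ d + 2 * (32 : ℕ)) ((2 * (32 : ℕ) + 1) / (1 - σ ^ 2) + 1) +
            2 * ((2 * (32 : ℕ) + 1) / (1 - σ ^ 2)) + 1) ^ d) ^ (merges G).card *
        (∏ e ∈ merges G, Q (wcntS sh G) σ (sh e).step ^ (d : ℝ)) *
          ((L : ℝ) ^ d) ^ partnerAges (PEv.step ∘ sh) G := by
  have hsK : ∀ u, u < K → s (u + 1) ≤ s u := fun u _ => hs u
  have hLF := levelFn_levelOf hsK (hdrop K)
  exact card_admZSet_le_of_birthRegionsD (sh := sh) W n (by omega) K hLF (by positivity) h0 h1 hσL hW hchr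
    (fun b hb => (births_facts_of_corr P G Z hc hR b hb).1) hk2 (birthRegionsD_of_corr hL hn hs hdrop hc hR hK) E hE
    z c₀'

end Consumers

/-! ## §3 Sanity (decided) -/

namespace SanityZOP

/-- the realised placement of a birth label with anchor `5` at level `1` on the torus with `2·2^3 = 16` sites
(`n = 2`, `L = 2`, `K = 3`; modulus at level `1`: `2·2^2 = 8`, `5 mod 8 = 5`): coordinate `2·5 = 10` -/
example : (placeD (ε := PEv × ℕ) (d := 1) Prod.fst (fun _ => (![5], {![5]})) 2 2 3 (by norm_num) (fun _ => 1)
    (((1, 0, 0) : PEv), 7) 0).val = 10 := by decide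

end SanityZOP

end

end Summit.QuantumFields.BalabanUV.T4Continuum.HistoryZones
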